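/-
Copyright (c) 2026 the pub-hodgecm-mathlib formalisation cell (harness21).  Prover seat hodgecm-mathlib-LH4-p12 (g0): MS ROAD-A brick L «CONGRUENCE UNITS STABILISE» dealt BY
SIGNATURE by the MS first seat LH4-p11 (g0) (MS-ROAD-A-BRICKS v2 2386a95463715ed5, step (3) = (3c-iii) cut), with brick K (a) as a corollary (§0).  2026-09-03.
-/
import Literature.NumberTheory.Automorphic.UnitaryLatticeTreeFrameChange     -- ★ (B-p14): `mapGL_conj_mapGL_eq_iff`, `mapGL` calculus (brings `UnitaryLatticeTreeDefs`: `latt`, `mapGL`)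
import Literature.NumberTheory.Automorphic.HermitianLatticesLocal            -- ★ `mem_integer_iff'`
import HarnessLib

/-!
# Crux `H413`, line LH4 «(D-RAM) FOUR-FRAME» road — MS ROAD A, step (3): diagonal CONGRUENCE UNITS STABILISE a boxed lattice (brick L), and `T`-stability is
# invariant under the diagonal group (brick K (a))

Cell `hodgecm-mathlib` (D-0151), FLOOR 0, crux item H413 = `stmt-HodgeConjecture-24833`, route of record `HCCMUnconditional`; squad F0∕P3c∕LH4 (req620 Track A), unit U3, the
(S-fin) ∕ MS road (LH4-p10 (g0) MEMO-stableLaw-finite v1; MS first seat LH4-p11 (g0), brick list v2): step (3) «orbit count» needs every stabiliser `S̃(M)` of a `T`-stable lattice to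
contain a principal congruence subgroup of the diagonal units, so that all indices in the orbit–stabiliser identity are FINITE.  THEOREMS ONLY (no `def`, no instance, no
notation, no `sorry`, default heartbeats); imports ★ only; lane `--supports stmt-HodgeConjecture-24833` (count-neutral).

WHAT IS PROVED.
* §0 (brick K (a)) `mapGL_diagonal_mapGL_diagonal_eq_iff`: for diagonal `Z = diag(z)`, `T = diag(s)` in `GL₃(K)` and any `M`: `T·(Z·M) = Z·M ↔ T·M = M` (diagonals commute;
  ★ `mapGL_conj_mapGL_eq_iff`).
* §1 `mapGL_diagonal_le_of_v_sub_one_le`: if `ϖμ_i e_i ∈ M` for all `i` and `|μ_i x_i| ≤ 1` on `M` (the two conjuncts of ★ p855198's box), then every diagonal `W = diag(w)` with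
  `|w_i − 1| ≤ |ϖ μ_i²|` maps `M` INTO itself: `W x = x + Σ_i c_i · (ϖμ_i e_i)` with `c_i = (w_i − 1)x_i ∕ (ϖμ_i)` integral.
* §2 (brick L, the signature dealt) `mapGL_diagonal_eq_of_v_sub_one_le`: under the same box hypotheses, `|u_i − 1| ≤ |ϖ μ_i²|` gives `U·M = M` for `U = diag(u)`.  The exponent
  of `|ϖ μ_i²| = exp(2m − 1)` is ODD, so the box bound (which forces `|ϖ μ_i²| ≤ 1`) gives `|u_i − 1| < 1`, hence `|u_i| = 1`, `|u_i⁻¹ − 1| = |u_i − 1|`, and §1 applies to `U`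
  and to `U⁻¹`.

HONEST LABEL.  Count-neutral bricks of the MS road (a re-line of the OPEN U3 (S) law); the verdict of record for (D-RAM) stays PRINT [LanglandsShelstad1989 Thm. p. 484 ∕ Rogawski1990
Prop. 4.9.1 (a)] ∕ XL; `HC_CM` is proved only modulo the 7 printed citations (2 remaining: hLiu418 = `stmt-HodgeConjecture-24832`, h413 = `stmt-HodgeConjecture-24833`) until rung 0 closes.

## References
* [Serre1980Trees] J.-P. Serre, *Trees* (1980), Ch. II §1.1 (lattices and their stabilisers in `GL_n` over a discretely valued field).
* [Kottwitz1986BaseChangeUnits] R. E. Kottwitz, *Base change for unit elements of Hecke algebras*, Compositio Math. 60 (1986), §1 pp. 240–241 (stabilisers of lattices fixed by a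
  regular torus element; congruence subgroups of the torus).
-/

set_option autoImplicit false

noncomputable section

namespace Summit.HodgeConjecture.HodgeConjecture.Cruxes.H413.F0P3cDyRamDiagonalCongruenceStabiliser

open scoped Valued WithZero Matrix MatrixGroups
open Literature.NumberTheory.Automorphic Literature.NumberTheory.Automorphic.UnitaryLatticeTree Literature.NumberTheory.Automorphic.HermitianLattice

variable {K : Type*} [Field K] [Valued K ℤᵐ⁰]

/-! ## §0  Brick K (a): `T`-stability is invariant under the diagonal group -/

omit [Valued K ℤᵐ⁰] in
/-- Two diagonal elements of `GL₃(K)` commute: `Z T Z⁻¹ = T`. [cite: Serre1980Trees, II.1.1] -/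
theorem diagonal_mul_diagonal_mul_inv_eq {z s : Fin 3 → K} (Z T : GL (Fin 3) K) (hZ : (Z : Matrix (Fin 3) (Fin 3) K) = Matrix.diagonal z)
    (hT : (T : Matrix (Fin 3) (Fin 3) K) = Matrix.diagonal s) : Z * T * Z⁻¹ = T := by
  have hcomm : Z * T = T * Z := by
    apply Units.ext
    rw [Units.val_mul, Units.val_mul, hZ, hT, Matrix.diagonal_mul_diagonal, Matrix.diagonal_mul_diagonal]
    congr 1
    funext i
    exact mul_comm _ _
  rw [hcomm, mul_inv_cancel_right]

/-- **BRICK K (a) · `T`-STABILITY IS `𝒢`-INVARIANT**: for diagonal `Z`, `T` and any lattice `M`, `T·(Z·M) = Z·M ↔ T·M = M`. [cite: Serre1980Trees, II.1.1]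
[cite: Kottwitz1986BaseChangeUnits, §1 pp. 240–241] -/
theorem mapGL_diagonal_mapGL_diagonal_eq_iff {z s : Fin 3 → K} (Z T : GL (Fin 3) K) (hZ : (Z : Matrix (Fin 3) (Fin 3) K) = Matrix.diagonal z)
    (hT : (T : Matrix (Fin 3) (Fin 3) K) = Matrix.diagonal s) (M : Submodule 𝒪[K] (Fin 3 → K)) :
    mapGL T (mapGL Z M) = mapGL Z M ↔ mapGL T M = M := by
  have h := mapGL_conj_mapGL_eq_iff Z T M
  rwa [diagonal_mul_diagonal_mul_inv_eq Z T hZ hT] at h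

/-! ## §1  A diagonal element congruent to `1` to depth `|ϖ μ_i²|` maps a boxed lattice into itself -/

/-- **DIAGONAL CONGRUENCE ELEMENTS MAP THE BOX INTO ITSELF**: if `ϖμ_i e_i ∈ M` and `|μ_i x_i| ≤ 1` for all `x ∈ M`, `i`, then for `W = diag(w)` with `|w_i − 1| ≤ |ϖ μ_i²|`:
`W·M ≤ M` — `W x = x + Σ_i ((w_i − 1)x_i∕(ϖμ_i))·(ϖμ_i e_i)` with integral coefficients. [cite: Kottwitz1986BaseChangeUnits, §1 pp. 240–241] [cite: Serre1980Trees, II.1.1] -/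
theorem mapGL_diagonal_le_of_v_sub_one_le {ϖ : K} (hϖ0 : ϖ ≠ 0) {μ : Fin 3 → K} (hμ : ∀ i, μ i ≠ 0) {M : Submodule 𝒪[K] (Fin 3 → K)}
    (hlo : ∀ i, (ϖ * μ i) • (Pi.single i 1 : Fin 3 → K) ∈ M) (hhi : ∀ x ∈ M, ∀ i, Valued.v (μ i * x i) ≤ 1)
    (w : Fin 3 → K) (hw : ∀ i, Valued.v (w i - 1) ≤ Valued.v (ϖ * μ i * μ i)) (W : GL (Fin 3) K) (hW : (W : Matrix (Fin 3) (Fin 3) K) = Matrix.diagonal w) :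
    mapGL W M ≤ M := by
  -- integral scalars act on `M`
  have hsmul : ∀ c : K, Valued.v c ≤ 1 → ∀ y ∈ M, c • y ∈ M := fun c hc y hy =>
    M.smul_mem (⟨c, (mem_integer_iff' c).2 hc⟩ : 𝒪[K]) hy
  rintro _ ⟨x, hx, rfl⟩
  -- `W x = (w_l x_l)_l`
  have heq : ((Matrix.toLin' (W : Matrix (Fin 3) (Fin 3) K)).restrictScalars 𝒪[K]) x =
      x + ∑ i : Fin 3, ((w i - 1) * x i / (ϖ * μ i)) • ((ϖ * μ i) • (Pi.single i 1 : Fin 3 → K)) := by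
    ext l
    rw [LinearMap.restrictScalars_apply, Matrix.toLin'_apply, hW, Matrix.mulVec_diagonal]
    simp only [Pi.add_apply, Finset.sum_apply, Pi.smul_apply, Pi.single_apply, smul_eq_mul, mul_ite, mul_one, mul_zero, Finset.sum_ite_eq,
      Finset.mem_univ, if_true]
    rw [div_mul_cancel₀ _ (mul_ne_zero hϖ0 (hμ l))]
    ring
  rw [heq]
  refine M.add_mem hx (M.sum_mem fun i _ => hsmul _ ?_ _ (hlo i))
  -- the coefficient `(w_i − 1)x_i ∕ (ϖμ_i)` is integral
  have hpos : 0 < Valued.v (ϖ * μ i) := (Valuation.pos_iff _).2 (mul_ne_zero hϖ0 (hμ i))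
  rw [map_div₀, div_le_one₀ hpos, map_mul]
  calc Valued.v (w i - 1) * Valued.v (x i) ≤ Valued.v (ϖ * μ i * μ i) * Valued.v (x i) := mul_le_mul_left (hw i) _
    _ = Valued.v (ϖ * μ i) * Valued.v (μ i * x i) := by rw [← map_mul, ← map_mul]; congr 1; ring
    _ ≤ Valued.v (ϖ * μ i) * 1 := mul_le_mul_right (hhi x hx i) _
    _ = Valued.v (ϖ * μ i) := mul_one _

/-! ## §2  Brick L: congruence units stabilise -/

/-- **BRICK L · CONGRUENCE UNITS STABILISE** (MS ROAD A step (3)): if `ϖμ_i e_i ∈ M` and `|μ_i x_i| ≤ 1` on `M` (★ p855198's box) then every diagonal UNIT `U = diag(u)` with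
`|u_i − 1| ≤ |ϖ μ_i²|` stabilises `M`: `U·M = M`.  (The box forces `|ϖ μ_i²| ≤ 1`, and `|ϖ μ_i²| = exp(2m − 1)` has ODD exponent, so `|u_i − 1| < 1`: `u_i` is a `1`-unit,
`|u_i⁻¹ − 1| = |u_i − 1|`, and §1 applies to `U` and `U⁻¹`.)  MEANING: `S̃(M)` contains a principal congruence subgroup of the diagonal torus, so every stabiliser index in
the orbit count is finite. [cite: Kottwitz1986BaseChangeUnits, §1 pp. 240–241] [cite: Serre1980Trees, II.1.1] -/
theorem mapGL_diagonal_eq_of_v_sub_one_le {ϖ : K} (hϖ : Valued.v ϖ = WithZero.exp (-1 : ℤ)) {μ : Fin 3 → K} (hμ : ∀ i, μ i ≠ 0) {M : Submodule 𝒪[K] (Fin 3 → K)}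
    (hlo : ∀ i, (ϖ * μ i) • (Pi.single i 1 : Fin 3 → K) ∈ M) (hhi : ∀ x ∈ M, ∀ i, Valued.v (μ i * x i) ≤ 1)
    (u : Fin 3 → K) (hu : ∀ i, Valued.v (u i - 1) ≤ Valued.v (ϖ * μ i * μ i)) (U : GL (Fin 3) K) (hU : (U : Matrix (Fin 3) (Fin 3) K) = Matrix.diagonal u) :
    mapGL U M = M := by
  have hϖ0 : ϖ ≠ 0 := (Valuation.ne_zero_iff _).1 (by rw [hϖ]; exact WithZero.exp_ne_zero)
  -- the box forces `|ϖ μ_i²| ≤ 1`, and the exponent `2m − 1` is odd, so in fact `|ϖ μ_i²| < 1`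
  have hlt : ∀ i, Valued.v (ϖ * μ i * μ i) < 1 := by
    intro i
    have hle : Valued.v (ϖ * μ i * μ i) ≤ 1 := by
      have h := hhi _ (hlo i) i
      rw [Pi.smul_apply, Pi.single_eq_same, smul_eq_mul, mul_one] at h
      rwa [show ϖ * μ i * μ i = μ i * (ϖ * μ i) by ring]
    obtain ⟨m, hm⟩ : ∃ m : ℤ, Valued.v (μ i) = WithZero.exp m :=
      ⟨WithZero.log (Valued.v (μ i)), (WithZero.exp_log ((Valuation.ne_zero_iff _).2 (hμ i))).symm⟩
    have hval : Valued.v (ϖ * μ i * μ i) = WithZero.exp (2 * m - 1) := by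
      rw [map_mul, map_mul, hϖ, hm, ← WithZero.exp_add, ← WithZero.exp_add]; congr 1; ring
    rw [hval, ← WithZero.exp_zero, WithZero.exp_lt_exp]
    rw [hval, ← WithZero.exp_zero, WithZero.exp_le_exp] at hle
    omega
  -- so every `u_i` is a `1`-unit
  have hu1 : ∀ i, Valued.v (u i) = 1 := fun i => by
    rw [show u i = 1 + (u i - 1) by ring]
    exact Valuation.map_one_add_of_lt _ ((hu i).trans_lt (hlt i))
  have hu0 : ∀ i, u i ≠ 0 := fun i => (Valuation.ne_zero_iff _).1 (by rw [hu1 i]; exact one_ne_zero)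
  -- `U⁻¹ = diag(u⁻¹)` with `|u_i⁻¹ − 1| = |u_i − 1|`
  have hUinv : ((U⁻¹ : GL (Fin 3) K) : Matrix (Fin 3) (Fin 3) K) = Matrix.diagonal fun i => (u i)⁻¹ := by
    rw [Matrix.coe_units_inv, hU]
    apply Matrix.inv_eq_left_inv
    rw [Matrix.diagonal_mul_diagonal, ← Matrix.diagonal_one]
    congr 1
    funext i
    exact inv_mul_cancel₀ (hu0 i)
  have huinv : ∀ i, Valued.v ((u i)⁻¹ - 1) ≤ Valued.v (ϖ * μ i * μ i) := fun i => by
    rw [show (u i)⁻¹ - 1 = -(u i - 1) / u i by rw [neg_sub, sub_div, div_self (hu0 i), one_div], map_div₀, Valuation.map_neg, hu1 i, div_one]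
    exact hu i
  -- §1 for `U` and for `U⁻¹`
  refine le_antisymm (mapGL_diagonal_le_of_v_sub_one_le hϖ0 hμ hlo hhi u hu U hU) ?_
  have h := mapGL_diagonal_le_of_v_sub_one_le hϖ0 hμ hlo hhi (fun i => (u i)⁻¹) huinv U⁻¹ hUinv
  have h' := (mapGL_le_mapGL_iff U _ _).2 h
  rwa [mapGL_mapGL_inv] at h'

end Summit.HodgeConjecture.HodgeConjecture.Cruxes.H413.F0P3cDyRamDiagonalCongruenceStabiliser

end
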